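import Summits.QuantumFields.BalabanUV.Beta.FP.SymmetryKHolds

/-!
# `BalabanUV.Beta.FP.PerfectRebase` — road «FP» for binder row D1, rows N0a-T / X1m: THE PERFECT `m`-FOLD STEP AT BASE `Lc` IS THE PERFECT ONE-STEP AT
# BASE `Lc^m` — the base-`Lc^m` step family `KStepUnit (Lc^m) j` IS, term by term, the arithmetic SUBSEQUENCE `j ↦ m·j` of the base-`Lc` (j, m)-family
# (exact, every `d`, `Lc`, `m`, `j`); hence (i) UNCONDITIONALLY (`d = 3`, `2 ≤ Lc`, `1 ≤ m`) the (j, m)-family CONVERGES ALONG `j ↦ m·j`, to the perfect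
# one-step resolvent at base `Lc^m` (gan24's K-slot END at base `Lc^m`, BY NAME), and (ii) under X1m-K the perfect `m`-fold resolvent
# `KPerf Lc (sfStep Lc) (smStep d Lc) m` EQUALS `KPerf (Lc^m) (sfStep (Lc^m)) (smStep d (Lc^m)) 1` — so X1m-K is exactly «the (j, m)-family is Cauchy»,
# its limit being already named and constructed

HONEST FRAMING (cell contract, verbatim): «discharging `BetaPertH` makes Bałaban's UV stability UNCONDITIONAL — a real constructive-QFT result;
it is NOT the continuum limit and NOT the Clay problem.»  THIS MODULE DISCHARGES NOTHING of the wall and does NOT prove X1m: it proves an exact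
re-indexing identity, one subsequence-convergence (from `GAN24.KSlotAssembly.convCKWall_holds` at base `Lc^m`, p204341, via `FP.SymmetryKHolds`) and one
identification UNDER X1m-K (entrywise convergence of the full (j, m)-family — a HYPOTHESIS, `StationarityK.dec_KPerf_succ`'s shape in the adopted
units).  READING (header clause only): the skeleton's «perfect `m`-fold step = ONE perfect step with blocking `Lc^m`» (N1) holds at the level of the
packed resolvents by a change of base, with no analysis beyond X1m-K.  Claim table `HOME/b2b-balaban-beta-d1-p3/LEAVES-FP.md` rows N0a-T / X1m-der
(unit `b2b-balaban-beta-d1-formalise-leaf-06`).  NOT BetaPertH, NOT continuum, NOT Clay.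
ABSOLUTE RULE (cell, verbatim): «No internally-minted statement may enter as a cited fact. Every hypothesis is either kernel-proved in this package or a
verbatim quotation of a PUBLISHED theorem with page reference.»  Nothing is cited; no `def … : Prop`; no binder instantiated at a value.

CONTENT (all [our object] / [folklore]).
* §1 EXACT RE-INDEXING (every `d`, `Lc ≥ 1`, `m`, `j`): `sfStep_pow`, `smStep_pow` (the adopted units at base `Lc^m`, step `j`, ARE those at base `Lc`,
  step `m·j`), `KTot_congr`, `KTot_pow_base` (`KTot ((Lc^m)^(j+1)) ((Lc^m)^j) = KTot (Lc^(m·j+m)) (Lc^(m·j))`), **`KStepUnit_pow_base`**: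
  `KStepUnit (Lc^m) j = unitK (sfStep Lc (m·j)) (smStep d Lc (m·j)) (KTot (Lc^(m·j+m)) (Lc^(m·j)))`.
* §2 SUBSEQUENCES UNDER THE CONSTRUCTED LIMIT: `limMKerOf_comp_eq_of_exists_tendsto` (a subsequence of an entrywise CONVERGENT family has the same
  constructed limit), `tendsto_mul_left_atTop'`.
* §3 **`KPerf_eq_KPerf_pow_base_of_exists_tendsto`**: X1m-K at `(Lc, m)`, `1 ≤ m` ⟹
  `KPerf Lc (sfStep Lc) (smStep d Lc) m = KPerf (Lc^m) (sfStep (Lc^m)) (smStep d (Lc^m)) 1`.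
* §4 (`d = 3`, `2 ≤ Lc`, `1 ≤ m`) **`exists_tendsto_jm_subseq_holds`** / **`tendsto_jm_subseq_KPerf_pow_base_holds`**: the (j, m)-family converges
  ALONG `j ↦ m·j`, entry by entry, to `KPerf (Lc^m) (sfStep (Lc^m)) (smStep 3 (Lc^m)) 1` — no hypothesis; and
  **`KPerf_eq_KPerf_pow_base_holds_of_exists_tendsto`**: under X1m-K the perfect `m`-fold resolvent IS that unconditional object, so it DECAYS,
  is BLOCK-COVARIANT and REFLECTION-INVARIANT at blocking `Lc^m` by `SymmetryKHolds.kernelSide_KPerf_one_holds` at base `Lc^m`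
  (`kernelSide_KPerf_of_exists_tendsto_holds`).
-/

namespace Summit.QuantumFields.BalabanUV.Beta.FP.PerfectRebase

open Filter Topology
open Literature.MathematicalPhysics.QuantumFieldTheory.Balaban1983to89
open Literature.MathematicalPhysics.QuantumFieldTheory.Balaban1983to89.Beta
open ExpKernelCalculus (MKer Decays shiftK)
open KernelReflection (refK)
open ResolventReflection (Φ)
open OneStepResolventKernel (Fib)
open OneStepKernelFamily (KInvStep)
open HessKerDressedLimit (limMKerOf limMKerOf_eq_of_tendsto)
open Summit.QuantumFields.BalabanUV.Beta.HessKerDressedUnits (unitK)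
open Summit.QuantumFields.BalabanUV.Beta.GAN24.CombesThomas (KStepUnit sfStep smStep)
open Summit.QuantumFields.BalabanUV.Beta.FP.PerfectObjects (KTot KInvStep_eq_KTot)
open Summit.QuantumFields.BalabanUV.Beta.FP.PerfectObjectsT (KPerf KPerf_one)
open Summit.QuantumFields.BalabanUV.Beta.FP.SymmetryK (tendsto_limMKerOf_of_exists)
open Summit.QuantumFields.BalabanUV.Beta.FP.SymmetryKHolds (exists_tendsto_KStepUnit tendsto_KStepUnit_KPerf_one kernelSide_KPerf_one_holds)

noncomputable section

/-! ## §1 Exact re-indexing: base `Lc^m`, step `j` = base `Lc`, step `m·j`, relative blocking `Lc^m` -/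

section Reindex

variable {d : ℕ} (Lc : ℕ) [NeZero Lc] (m : ℕ)

omit [NeZero Lc] in
/-- [folklore] The field unit at base `Lc^m`, step `j`, is the field unit at base `Lc`, step `m·j`. -/
theorem sfStep_pow (j : ℕ) : sfStep (Lc ^ m) j = sfStep Lc (m * j) := by
  unfold sfStep
  rw [Nat.cast_pow, ← pow_mul]

omit [NeZero Lc] in
/-- [folklore] The multiplier unit at base `Lc^m`, step `j`, is the multiplier unit at base `Lc`, step `m·j`. -/
theorem smStep_pow (j : ℕ) : smStep d (Lc ^ m) j = smStep d Lc (m * j) := by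
  unfold smStep
  rw [Nat.cast_pow, ← pow_mul, mul_assoc]

/-- [folklore] `KTot` only depends on the value of its blocking (the `NeZero` instance is a proposition). -/
theorem KTot_congr {n n' : ℕ} [NeZero n] [NeZero n'] (h : n = n') (M : ℕ) : KTot (d := d) n M = KTot (d := d) n' M := by
  subst h
  rfl

/-- [folklore] The (j, 1)-resolvent at base `Lc^m` is the (m·j, m)-resolvent at base `Lc`. -/
theorem KTot_pow_base (j : ℕ) : KTot (d := d) ((Lc ^ m) ^ (j + 1)) ((Lc ^ m) ^ j) = KTot (d := d) (Lc ^ (m * j + m)) (Lc ^ (m * j)) := by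
  rw [KTot_congr (d := d) (show (Lc ^ m) ^ (j + 1) = Lc ^ (m * j + m) by rw [← pow_mul, Nat.mul_succ]) ((Lc ^ m) ^ j), ← pow_mul]

/-- [our object] **THE BASE-`Lc^m` STEP FAMILY IS THE ARITHMETIC SUBSEQUENCE OF THE BASE-`Lc` (j, m)-FAMILY — EXACTLY**:
`KStepUnit (Lc^m) j = unitK (sfStep Lc (m·j)) (smStep d Lc (m·j)) (KTot (Lc^(m·j+m)) (Lc^(m·j)))` (every `d`, `Lc ≥ 1`, `m`, `j`). -/
theorem KStepUnit_pow_base (j : ℕ) :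
    KStepUnit (d := d) (Lc ^ m) j = unitK (sfStep Lc (m * j)) (smStep d Lc (m * j)) (KTot (d := d) (Lc ^ (m * j + m)) (Lc ^ (m * j))) := by
  rw [KStepUnit, KInvStep_eq_KTot, KTot_pow_base, sfStep_pow, smStep_pow]

end Reindex

/-! ## §2 Subsequences under the constructed limit -/

section Subseq

variable {D : ℕ} {F : Type*}

/-- [folklore] `j ↦ m·j` tends to infinity for `1 ≤ m`. -/
theorem tendsto_mul_left_atTop' {m : ℕ} (hm : 1 ≤ m) : Tendsto (fun j : ℕ => m * j) atTop atTop :=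
  tendsto_atTop_mono (fun j => Nat.le_mul_of_pos_left j hm) tendsto_id

/-- [folklore] **A SUBSEQUENCE OF AN ENTRYWISE CONVERGENT FAMILY HAS THE SAME CONSTRUCTED LIMIT** (`φ → ∞`). -/
theorem limMKerOf_comp_eq_of_exists_tendsto {K : ℕ → MKer D F} {φ : ℕ → ℕ} (hφ : Tendsto φ atTop atTop)
    (h : ∀ x y a b, ∃ L : ℝ, Tendsto (fun j => K j x y a b) atTop (𝓝 L)) :
    limMKerOf (fun j => K (φ j)) = limMKerOf K :=
  limMKerOf_eq_of_tendsto fun x y a b => (tendsto_limMKerOf_of_exists h x y a b).comp hφ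

end Subseq

/-! ## §3 Under X1m-K: the perfect `m`-fold resolvent is the perfect one-step resolvent at base `Lc^m` -/

section Identify

variable {d : ℕ} (Lc : ℕ) [NeZero Lc] (m : ℕ)

/-- [our object] The defining family of `KPerf (Lc^m) (sfStep (Lc^m)) (smStep d (Lc^m)) 1` IS the subsequence `j ↦ m·j` of the defining family of
`KPerf Lc (sfStep Lc) (smStep d Lc) m` (`funext KStepUnit_pow_base`). -/
theorem KPerf_pow_base_one_eq :
    KPerf (d := d) (Lc ^ m) (sfStep (Lc ^ m)) (smStep d (Lc ^ m)) 1 =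
      limMKerOf (fun j => unitK (sfStep Lc (m * j)) (smStep d Lc (m * j)) (KTot (d := d) (Lc ^ (m * j + m)) (Lc ^ (m * j)))) := by
  rw [KPerf_one]
  exact congrArg limMKerOf (funext fun j => KStepUnit_pow_base (d := d) Lc m j)

/-- **THE PERFECT `m`-FOLD RESOLVENT IS THE PERFECT ONE-STEP RESOLVENT AT BASE `Lc^m`, UNDER X1m-K** (`1 ≤ m`, any `d`, `Lc ≥ 1`): if the unit-rescaled
(j, m)-family converges entrywise, `KPerf Lc (sfStep Lc) (smStep d Lc) m = KPerf (Lc^m) (sfStep (Lc^m)) (smStep d (Lc^m)) 1`. [our object] -/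
theorem KPerf_eq_KPerf_pow_base_of_exists_tendsto (hm : 1 ≤ m)
    (hconv : ∀ x y a b, ∃ L : ℝ,
      Tendsto (fun j => unitK (sfStep Lc j) (smStep d Lc j) (KTot (d := d) (Lc ^ (j + m)) (Lc ^ j)) x y a b) atTop (𝓝 L)) :
    KPerf (d := d) Lc (sfStep Lc) (smStep d Lc) m = KPerf (d := d) (Lc ^ m) (sfStep (Lc ^ m)) (smStep d (Lc ^ m)) 1 := by
  rw [KPerf_pow_base_one_eq (d := d) Lc m, KPerf]
  exact (limMKerOf_comp_eq_of_exists_tendsto (K := fun j => unitK (sfStep Lc j) (smStep d Lc j) (KTot (d := d) (Lc ^ (j + m)) (Lc ^ j)))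
    (tendsto_mul_left_atTop' hm) hconv).symm

end Identify

/-! ## §4 Dimension four: the (j, m)-family converges along `j ↦ m·j` with NO hypothesis -/

section Holds

variable {Lc : ℕ} [NeZero Lc] {m : ℕ}

omit [NeZero Lc] in
/-- [folklore] `2 ≤ Lc`, `1 ≤ m` ⟹ `2 ≤ Lc^m`. -/
theorem two_le_pow (hLc : 2 ≤ Lc) (hm : 1 ≤ m) : 2 ≤ Lc ^ m :=
  hLc.trans (Nat.le_self_pow (Nat.one_le_iff_ne_zero.1 hm) Lc)

/-- **X1m-K HOLDS ALONG THE ARITHMETIC SUBSEQUENCE, UNCONDITIONALLY** (`d = 3`, `2 ≤ Lc`, `1 ≤ m`): every entry of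
`j ↦ unitK (sfStep Lc (m·j)) (smStep 3 Lc (m·j)) (KTot (Lc^(m·j+m)) (Lc^(m·j)))` converges — gan24's K-slot END at base `Lc^m` (`SymmetryKHolds.exists_tendsto_KStepUnit`)
re-indexed by `KStepUnit_pow_base`. [our object] -/
theorem exists_tendsto_jm_subseq_holds (hLc : 2 ≤ Lc) (hm : 1 ≤ m) (x y : Fin (3 + 1) → ℤ) (a b : Fib 3) :
    ∃ L : ℝ, Tendsto (fun j => unitK (sfStep Lc (m * j)) (smStep 3 Lc (m * j)) (KTot (d := 3) (Lc ^ (m * j + m)) (Lc ^ (m * j))) x y a b)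
      atTop (𝓝 L) := by
  have h := exists_tendsto_KStepUnit (Lc := Lc ^ m) (two_le_pow hLc hm) x y a b
  simpa only [KStepUnit_pow_base] using h

/-- **… AND THE LIMIT ALONG THE SUBSEQUENCE IS THE PERFECT ONE-STEP RESOLVENT AT BASE `Lc^m`** (entry by entry; `d = 3`, `2 ≤ Lc`, `1 ≤ m`). [our object] -/
theorem tendsto_jm_subseq_KPerf_pow_base_holds (hLc : 2 ≤ Lc) (hm : 1 ≤ m) (x y : Fin (3 + 1) → ℤ) (a b : Fib 3) :
    Tendsto (fun j => unitK (sfStep Lc (m * j)) (smStep 3 Lc (m * j)) (KTot (d := 3) (Lc ^ (m * j + m)) (Lc ^ (m * j))) x y a b) atTop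
      (𝓝 (KPerf (d := 3) (Lc ^ m) (sfStep (Lc ^ m)) (smStep 3 (Lc ^ m)) 1 x y a b)) := by
  have h := tendsto_KStepUnit_KPerf_one (Lc := Lc ^ m) (two_le_pow hLc hm) x y a b
  simpa only [KStepUnit_pow_base] using h

/-- **UNDER X1m-K THE PERFECT `m`-FOLD RESOLVENT IS THE UNCONDITIONAL OBJECT** `KPerf (Lc^m) (sfStep (Lc^m)) (smStep 3 (Lc^m)) 1` (`d = 3`, `1 ≤ m`): X1m-K is
thus EXACTLY «the (j, m)-family is Cauchy» — its limit is already constructed and named. [our object] -/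
theorem KPerf_eq_KPerf_pow_base_holds_of_exists_tendsto (hm : 1 ≤ m)
    (hconv : ∀ x y a b, ∃ L : ℝ,
      Tendsto (fun j => unitK (sfStep Lc j) (smStep 3 Lc j) (KTot (d := 3) (Lc ^ (j + m)) (Lc ^ j)) x y a b) atTop (𝓝 L)) :
    KPerf (d := 3) Lc (sfStep Lc) (smStep 3 Lc) m = KPerf (d := 3) (Lc ^ m) (sfStep (Lc ^ m)) (smStep 3 (Lc ^ m)) 1 :=
  KPerf_eq_KPerf_pow_base_of_exists_tendsto (d := 3) Lc m hm hconv

/-- **HENCE, UNDER X1m-K, THE KERNEL-SIDE BINDERS AT BLOCKING `Lc^m` ARE THE UNCONDITIONAL ONES OF BASE `Lc^m`** (`d = 3`, `2 ≤ Lc`, `1 ≤ m`): the perfect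
`m`-fold resolvent decays, is block-covariant under the `Lc^m`-translations and reflection-invariant for every axis — `SymmetryKHolds.kernelSide_KPerf_one_holds` at
base `Lc^m`, transported by the identification. (Same conclusion as `SymmetryK.kernelSide_KPerf`, with the decay constant now the base-`Lc^m` K-slot's.) [our object] -/
theorem kernelSide_KPerf_of_exists_tendsto_holds (hLc : 2 ≤ Lc) (hm : 1 ≤ m)
    (hconv : ∀ x y a b, ∃ L : ℝ,
      Tendsto (fun j => unitK (sfStep Lc j) (smStep 3 Lc j) (KTot (d := 3) (Lc ^ (j + m)) (Lc ^ j)) x y a b) atTop (𝓝 L)) :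
    (∃ δ₀ C₀ : ℝ, 0 < δ₀ ∧ 0 ≤ C₀ ∧ Decays (KPerf (d := 3) Lc (sfStep Lc) (smStep 3 Lc) m) C₀ δ₀) ∧
    (∀ t : Fin (3 + 1) → ℤ, shiftK (-(((Lc ^ m : ℕ) : ℤ) • t)) (KPerf (d := 3) Lc (sfStep Lc) (smStep 3 Lc) m) = KPerf Lc (sfStep Lc) (smStep 3 Lc) m) ∧
    (∀ α : Fin (3 + 1), refK (Φ (d := 3) (Lc ^ m) α) (KPerf (d := 3) Lc (sfStep Lc) (smStep 3 Lc) m) = KPerf Lc (sfStep Lc) (smStep 3 Lc) m) := by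
  rw [KPerf_eq_KPerf_pow_base_holds_of_exists_tendsto hm hconv]
  exact kernelSide_KPerf_one_holds (Lc := Lc ^ m) (two_le_pow hLc hm)

end Holds

end

end Summit.QuantumFields.BalabanUV.Beta.FP.PerfectRebase
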